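import Mathlib
import Summits.NavierStokesRegularity.NavierStokesRegularity.Theorems.FilamentSkeletonRssNearStraightEscape

/-!
# The GEOMETRY BLOCK of `FlatJ1G` in the near-straight regime, for free (`cg = 7/8`)
# (`FilamentSkeletonRss`, child crux `TangentSkeletonNearStraight`, stmt-NavierStokesRegularity-28295, line
# `child_tangent_analytic_strip`, ∃-side of the registered stub `stub_analyticClosing`, step (v): "escape, chord-arc … are inequalities
# checked on the design")

In the near-straight regime of the child crux (`NearStraightJ1G`: tangent oscillation `‖X_j′(τ) − X_j′(σ)‖ ≤ Rb ≤ ½`, unit speed) three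
clauses of the flat block `FlatJ1G` hold AUTOMATICALLY with the universal constant `cg = 7/8`, whatever `ρ`, `Rw`, `Γ`:
* chord–arc (clause 5)  `∀ τ σ, ρ√Γ ≤ |τ − σ| → cg·ρ√Γ ≤ ‖X_j τ − X_j σ‖`   (`chordArc_of_nearStraight`),
* escape (clause 6)     `∀ τ, cg·|τ − c_j| ≤ Rw√Γ + ‖X_j τ‖` given the waist clause `‖X_j(c_j)‖ ≤ Rw√Γ`   (`escape_of_nearStraight`),
* properness (in clause 2) `Tendsto (fun τ => ‖X_j τ‖) (cocompact ℝ) atTop`   (`tendsto_norm_of_nearStraight`),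
all from the landed linear escape `(7/8)|σ − σ₀| ≤ ‖X σ − X σ₀‖` (Theorems.NearStraightEscape.chord_ge_seven_eighths, p817529).
`geometryBlock_of_nearStraight` packages the three in the letter of the clauses for an `N`-tuple.  With the area block (Theorems.AreaLawSlaving,
parts 1–10) this exhausts the "inequalities checked on the design" of step (v) except the slip sign (Theorems.SkeletonJ1NormalBlockWindow
.areaLaw_pos_of_lt / areaLaw_neg_of_lt, free from the area law).

HONEST FRAMING: elementary geometry of a HYPOTHETICAL filament skeleton on the NEGATIVE side of a MODEL route (A1G aside); nothing here bears
on Navier–Stokes regularity or blow-up; no registered stub is closed.  `--supports stmt-NavierStokesRegularity-28295`.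
-/

set_option linter.dupNamespace false

noncomputable section

namespace Summit.NavierStokesRegularity.NavierStokesRegularity.Theorems.NearStraightGeometry

open Set Filter
open Summit.NavierStokesRegularity.NavierStokesRegularity.Theorems.NearStraightEscape

/-- **Chord–arc clause for free** (`cg = 7/8`): `ρ′ ≤ |τ − σ| → (7/8)·ρ′ ≤ ‖X τ − X σ‖` for any threshold `ρ′ ≥ 0`
(in the crux `ρ′ = ρ√Γ`). [folklore] -/
theorem chordArc_of_nearStraight {X : ℝ → EuclideanSpace ℝ (Fin 3)} {Rb : ℝ} (hX : Differentiable ℝ X)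
    (hunit : ∀ τ, ‖deriv X τ‖ = 1) (hosc : ∀ τ σ, ‖deriv X τ - deriv X σ‖ ≤ Rb) (hRb : Rb ≤ 1 / 2)
    {ρ' : ℝ} (τ σ : ℝ) (h : ρ' ≤ |τ - σ|) : 7 / 8 * ρ' ≤ ‖X τ - X σ‖ := by
  have hc := chord_ge_seven_eighths hX hunit hosc hRb σ τ
  have : 7 / 8 * ρ' ≤ 7 / 8 * |τ - σ| := mul_le_mul_of_nonneg_left h (by norm_num)
  exact this.trans hc

/-- **Escape clause for free** (`cg = 7/8`): if `‖X(c)‖ ≤ R` (the waist clause, `R = Rw√Γ`) then `(7/8)|τ − c| ≤ R + ‖X τ‖`. [folklore] -/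
theorem escape_of_nearStraight {X : ℝ → EuclideanSpace ℝ (Fin 3)} {Rb : ℝ} (hX : Differentiable ℝ X)
    (hunit : ∀ τ, ‖deriv X τ‖ = 1) (hosc : ∀ τ σ, ‖deriv X τ - deriv X σ‖ ≤ Rb) (hRb : Rb ≤ 1 / 2)
    {c R : ℝ} (hwaist : ‖X c‖ ≤ R) (τ : ℝ) : 7 / 8 * |τ - c| ≤ R + ‖X τ‖ := by
  have hc := chord_ge_seven_eighths hX hunit hosc hRb c τ
  have htri : ‖X τ - X c‖ ≤ ‖X τ‖ + ‖X c‖ := norm_sub_le _ _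
  linarith

/-- **Properness for free**: `‖X τ‖ → ∞` along the cocompact filter of `ℝ`. [folklore] -/
theorem tendsto_norm_of_nearStraight {X : ℝ → EuclideanSpace ℝ (Fin 3)} {Rb : ℝ} (hX : Differentiable ℝ X)
    (hunit : ∀ τ, ‖deriv X τ‖ = 1) (hosc : ∀ τ σ, ‖deriv X τ - deriv X σ‖ ≤ Rb) (hRb : Rb ≤ 1 / 2) :
    Tendsto (fun τ => ‖X τ‖) (cocompact ℝ) atTop := by
  have hlow : ∀ τ, 7 / 8 * |τ - 0| - ‖X 0‖ ≤ ‖X τ‖ := by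
    intro τ
    have := escape_of_nearStraight hX hunit hosc hRb (c := 0) le_rfl τ
    linarith
  refine tendsto_atTop_mono hlow ?_
  rw [cocompact_eq_atBot_atTop]
  refine tendsto_sup.2 ⟨?_, ?_⟩
  · rw [tendsto_atBot_atTop]
    intro b
    refine ⟨-(8 / 7 * (|b| + ‖X 0‖)), fun a ha => ?_⟩
    have h1 : 8 / 7 * (|b| + ‖X 0‖) ≤ |a - 0| := by
      rw [sub_zero]
      have : -a ≤ |a| := neg_le_abs a
      have hpos : 0 ≤ |b| + ‖X 0‖ := by positivity
      linarith
    have h2 : b ≤ |b| := le_abs_self b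
    nlinarith [norm_nonneg (X 0), abs_nonneg b]
  · rw [tendsto_atTop_atTop]
    intro b
    refine ⟨8 / 7 * (|b| + ‖X 0‖), fun a ha => ?_⟩
    have h1 : 8 / 7 * (|b| + ‖X 0‖) ≤ |a - 0| := by
      rw [sub_zero]; exact ha.trans (le_abs_self a)
    have h2 : b ≤ |b| := le_abs_self b
    nlinarith [norm_nonneg (X 0), abs_nonneg b]

/-- **The geometry block of `FlatJ1G` in the near-straight regime**, in the letter of the clauses, for an `N`-tuple: chord–arc with
`cg = 7/8` at the threshold `ρ√Γ`, escape with `cg = 7/8` from the waist clause, and properness. [folklore] -/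
theorem geometryBlock_of_nearStraight {N : ℕ} {X : Fin N → ℝ → EuclideanSpace ℝ (Fin 3)} {c : Fin N → ℝ} {Rb ρ Rw Γ : ℝ}
    (hX : ∀ j, Differentiable ℝ (X j)) (hunit : ∀ j τ, ‖deriv (X j) τ‖ = 1)
    (hosc : ∀ j τ σ, ‖deriv (X j) τ - deriv (X j) σ‖ ≤ Rb) (hRb : Rb ≤ 1 / 2) (hwaist : ∀ j, ‖X j (c j)‖ ≤ Rw * √Γ) :
    (∀ j τ σ, ρ * √Γ ≤ |τ - σ| → 7 / 8 * ρ * √Γ ≤ ‖X j τ - X j σ‖) ∧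
    (∀ j τ, 7 / 8 * |τ - c j| ≤ Rw * √Γ + ‖X j τ‖) ∧
    (∀ j, Tendsto (fun τ => ‖X j τ‖) (cocompact ℝ) atTop) := by
  refine ⟨fun j τ σ h => ?_, fun j τ => escape_of_nearStraight (hX j) (hunit j) (hosc j) hRb (hwaist j) τ,
    fun j => tendsto_norm_of_nearStraight (hX j) (hunit j) (hosc j) hRb⟩
  have := chordArc_of_nearStraight (hX j) (hunit j) (hosc j) hRb τ σ h
  linarith

end Summit.NavierStokesRegularity.NavierStokesRegularity.Theorems.NearStraightGeometry

end
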